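import Summits.QuantumFields.QCD.Theses.GapBuysCauchyRate
import Summits.QuantumFields.QCD.Theses.CounterexampleMustBeHot
import Summits.QuantumFields.QCD.Theorems.QuarksAsStableActionStableActionBridgeDefs
import Literature.MathematicalPhysics.QuantumFieldTheory.MassGapFromLatticeClustering
import Summits.QuantumFields.QCD.Theorems.GapBuysCauchyRateConvergentOSClosureStubSoftClosure
import Summits.QuantumFields.QCD.Theorems.GapBuysCauchyRateConvergentOSClosureStubAsymptoticTranslation
import Summits.QuantumFields.QCD.Theorems.GapBuysCauchyRateConvergentOSClosureStubSpeciesPackaging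
import Summits.QuantumFields.QCD.Theorems.GapBuysCauchyRateConvergentOSClosureStubRpOfComparison
import Summits.QuantumFields.QCD.Theorems.GapBuysCauchyRateCauchySummation
import Literature.MathematicalPhysics.QuantumFieldTheory.QCDAsymptoticScalingCouplingDivergence
import HarnessLib.Audit

/-!
# ROUTE-LEVEL re-type package for crux `ConvergentOSClosure` (item stmt-QuantumFields-11525) — lead c3, 2026-08-17

For the PLANNER (this is the piece the three earlier leads did not deliver).  Four independent lead seats (0, c1, c2, c3)
found the crux MISSTATED: its eight hypotheses do not carry the four lattice-side inputs its conclusion needs — (T) a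
k-uniform E0′ bound, (COMP) the periodic ↔ Θ-symmetrised thermal comparison in E0′ norm, (CL) k-uniform spatial
clustering, (CS) species Cauchy–Schwarz clustering — and the repaired crux R′ (lead c2, `Retype.lean`,
`ConvergentOSClosureRetyped` below, VERBATIM) is a THEOREM over the landed files p147393 / p149834 / p150754 / p152669.
Re-typing the crux alone breaks the two assemblies that consume it; this file supplies the matching re-types of the
two PRODUCERS and re-certifies both assemblies, so that the whole re-type is copy-paste:

* §1 `ConvergentOSClosureRetyped` — R′ (c2), one line, + `convergentOSClosureRetyped_holds` (its complete proof).
* §2 `LadderCauchyRateRetyped` — `GapBuysCauchyRate.LadderCauchyRate` (stmt-QuantumFields-17307) with the three clauses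
  (T ∧ COMP), CL, CS inserted per mass tuple `m` between the κ₃ clause and the rate clause (text otherwise byte-identical;
  `N_f ≤ 16` is automatic from `N_f = 2 ∨ N_f = 3`); `ladderCauchyRateRetyped_imp` : it implies the current text.
* §3 `closesRetyped` — the route's deciding theorem re-certified on the re-typed items
  (`LadderCauchyRateRetyped → CauchySummation → ConvergentOSClosureRetyped → RotationRestoration → QCD`), and
  `qcd_of_ladderRetyped` : `LadderCauchyRateRetyped → RotationRestoration → QCD` — after the re-type the route is DOWN TO
  TWO open cruxes (the ladder and E1), `CauchySummation` (p-landed `cauchySummation_proof`) and R′ being theorems.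
* §4 the `CounterexampleMustBeHot` copy (support r9 of that route, consumed by the split of `ChiralContinuumComplement`,
  stmt-QuantumFields-17304, skeleton `Cruxes/ChiralContinuumComplement/Lines/pieces.lean`): `ChiralCalibratedConvergenceRetyped`
  (stmt-QuantumFields-18044 with the same three clauses appended per `m`), `chiralContinuumComplement_of_retyped`
  (the split's glue re-certified) and `chiralContinuumComplement_of_ladder'` (piece 2 discharged by R′).

Plain-text signatures for `ledger route edit` (everything after `:=`, one line each; the `open … in` prefix gains
`Summit.QuantumFields.QCD.Cruxes.StableActionBridge.Sketch`, and the route files need the two extra imports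
`Summits.QuantumFields.QCD.Theorems.QuarksAsStableActionStableActionBridgeDefs` and
`Literature.MathematicalPhysics.QuantumFieldTheory.MassGapFromLatticeClustering`): `ConvergentOSClosureRetyped-signature.txt`
(4513 chars), `LadderCauchyRateRetyped-signature.txt` (3359 chars), `ChiralCalibratedConvergenceRetyped-signature.txt` (3559 chars)
— attached to the item next to this file.

This file elaborates rc 0, sorries 0 (lean check, 2026-08-17); axioms of every theorem ⊆ {propext, Classical.choice, Quot.sound}.
-/

namespace Summit.QuantumFields.QCD.Cruxes.ConvergentOSClosure.RetypeRoute

open scoped BigOperators Topology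
open Filter

/-! ## §1 The re-typed crux R′ (lead c2, verbatim) and its proof -/

/-- **R′ — the re-typed `ConvergentOSClosure`** (both route copies): the typed hypotheses, `N_f ≤ 16`, and per `(reg, 𝒞, m)`
the clauses (T ∧ COMP), CL, CS; conclusion VERBATIM. -/
def ConvergentOSClosureRetyped : Prop :=
  open Literature.MathematicalPhysics.QuantumFieldTheory Literature.MathematicalPhysics.QuantumLattice Literature.MathematicalPhysics.AQFT Summit.QuantumFields.QCD.Cruxes.StableActionBridge.Sketch in ∀ (Nf : ℕ) (reg : QCDRegularisation Nf) (𝒞 : CalibratedSpeciesFamily reg) (m : Fin Nf → ℝ), Nf ≤ 16 → (∀ f, 0 < m f) → (𝒞.scheme m).HasAsymptoticScaling → (∀ fl : Fin Nf, ∀ᶠ k in Filter.atTop, -1 < (𝒞.scheme m).mq fl k) → (∃ Δ > 0, (𝒞.scheme m).HasLatticeMassGap Δ) → (∀ᶠ k in Filter.atTop, (𝒞.scheme m).twoPoint k QCDField.glue QCDField.glue (thetaTest 4 𝒞.f₀) 𝒞.f₀ = 1) → (∀ f g : Fin Nf, f ≠ g → ∀ᶠ k in Filter.atTop, (𝒞.scheme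 m).twoPoint k (QCDField.pseudoRe f g) (QCDField.pseudoRe f g) (thetaTest 4 𝒞.f₀) 𝒞.f₀ = 1) → (∃ f g h : SchwartzMap (EuclideanSpace ℝ (Fin 4)) ℝ, tsupport (f : EuclideanSpace ℝ (Fin 4) → ℝ) ⊆ {x | x 0 < 0} ∧ tsupport (g : EuclideanSpace ℝ (Fin 4) → ℝ) ⊆ {x | 0 < x 0 ∧ x 0 < 1} ∧ tsupport (h : EuclideanSpace ℝ (Fin 4) → ℝ) ⊆ {x | 1 < x 0} ∧ ∃ ε > (0 : ℝ), ∀ᶠ k in Filter.atTop, ε ≤ ‖qcdLatticeSchwinger (𝒞.scheme m) k 3 ![QCDField.glue, QCDField.glue, QCDField.glue] ![f, g, h] - qcdLatticeSchwinger (𝒞.scheme m) k 1 ![QCDField.glue] ![f] * qcdLatticeSchwinger (𝒞.scheme m) k 2 ![QCDField.glue, QCDField.glue] ![g, h] - qcdLatticeSchwinger (𝒞.scheme m) k 1 ![QCDField.glue] ![g] * qcdLatticeSchwinger (𝒞.scheme m) k 2 ![QCDField.glue, QCDField.glue] ![f, h] - qcdLatticeSchwinger (𝒞.scheme m) k 1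 ![QCDField.glue] ![h] * qcdLatticeSchwinger (𝒞.scheme m) k 2 ![QCDField.glue, QCDField.glue] ![f, g] + 2 * (qcdLatticeSchwinger (𝒞.scheme m) k 1 ![QCDField.glue] ![f] * qcdLatticeSchwinger (𝒞.scheme m) k 1 ![QCDField.glue] ![g] * qcdLatticeSchwinger (𝒞.scheme m) k 1 ![QCDField.glue] ![h])‖) → (∀ n : ℕ, n ≠ 0 → ∀ (σ : Fin n → QCDField Nf) (f : Fin n → SchwartzMap (EuclideanSpace ℝ (Fin 4)) ℝ) (F : SchwartzMap (Fin n → EuclideanSpace ℝ (Fin 4)) ℂ), IsTensorOf F (fun i => ofRealTest (f i)) → IsOffDiagonal F → ∃ c : ℂ, Filter.Tendsto (fun k : ℕ => qcdLatticeSchwinger (𝒞.scheme m) k n σ f) Filter.atTop (nhds c)) → (∃ (s : ℕ) (α β : ℝ), 0 ≤ α ∧ (∀ (n : ℕ) (σ : Fin n → QCDField Nf), ∀ᶠ k in Filter.atTop, ∀ F : SchwartzMap (Fin n → EuclideanSpace ℝ (Fin 4)) ℂ, IsOffDiagonal F → ‖qcdLatticeDist (𝒞.scheme m) k n σ F‖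 ≤ α * (n.factorial : ℝ) ^ β * schwartzNorm (n * s) F) ∧ (∀ ε : ℝ, 0 < ε → ∀ (n : ℕ) (σ : Fin n → QCDField Nf), ∀ᶠ k in Filter.atTop, ∀ F : SchwartzMap (Fin n → EuclideanSpace ℝ (Fin 4)) ℂ, IsOffDiagonal F → ‖qcdLatticeDistSymAP (𝒞.scheme m) k n σ F - qcdLatticeDist (𝒞.scheme m) k n σ F‖ ≤ ε * schwartzNorm (n * s) F)) → (∀ (n n' : ℕ) (σ : Fin n → QCDField Nf) (σ' : Fin n' → QCDField Nf) (F : SchwartzMap (Fin n → EuclideanSpace ℝ (Fin 4)) ℂ) (G : SchwartzMap (Fin n' → EuclideanSpace ℝ (Fin 4)) ℂ), IsTimeOrdered F → IsTimeOrdered G → ∀ a : EuclideanSpace ℝ (Fin 4), a 0 = 0 → a ≠ 0 → ∀ ε : ℝ, 0 < ε → ∃ t₀ : ℝ, ∀ t : ℝ, t₀ ≤ t → ∀ H : SchwartzMap (Fin (n + n') → EuclideanSpace ℝ (Fin 4)) ℂ, IsAppendTensorOf H (osAdjoint F) (translateMulti (t • a) G) → ∀ᶠ k in Filter.atTop, ‖qcdLatticeDist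 (𝒞.scheme m) k (n + n') (Fin.append (σ ∘ Fin.rev) σ') H - qcdLatticeDist (𝒞.scheme m) k n (σ ∘ Fin.rev) (osAdjoint F) * qcdLatticeDist (𝒞.scheme m) k n' σ' G‖ ≤ ε) → (∃ Δ' > 0, (𝒞.scheme m).HasSpeciesCSClustering Δ') → ∃ S : LabelledSchwingerFamily (QCDField Nf) (EuclideanSpace ℝ (Fin 4)), S.IsNormalized ∧ S.IsHermitian ∧ S.HasLinearGrowth ∧ (∀ (n : ℕ) (σ : Fin n → QCDField Nf) (a : EuclideanSpace ℝ (Fin 4)) (F : SchwartzMap (Fin n → EuclideanSpace ℝ (Fin 4)) ℂ), IsOffDiagonal F → S n σ (translateMulti a F) = S n σ F) ∧ S.IsReflectionPositive ∧ S.IsSymmetric ∧ S.HasClusterProperty ∧ (∀ n : ℕ, n ≠ 0 → ∀ (σ : Fin n → QCDField Nf) (f : Fin n → SchwartzMap (EuclideanSpace ℝ (Fin 4)) ℝ) (F : SchwartzMap (Fin n → EuclideanSpace ℝ (Fin 4)) ℂ), IsTensorOf F (fun i => ofRealTest (f i)) → IsOffDiagonal F → Filter.Tendsto (fun k : ℕ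 => qcdLatticeSchwinger (𝒞.scheme m) k n σ f) Filter.atTop (nhds (S n σ F))) ∧ (∃ Δ : ℝ, 0 < Δ ∧ S.HasMassGap Δ ∧ (𝒞.scheme m).HasLatticeMassGap Δ) ∧ ((∀ (n : ℕ) (σ : Fin n → QCDField Nf) (Rot : EuclideanSpace ℝ (Fin 4) ≃ₗᵢ[ℝ] EuclideanSpace ℝ (Fin 4)), LinearMap.det (Rot.toLinearEquiv : EuclideanSpace ℝ (Fin 4) →ₗ[ℝ] EuclideanSpace ℝ (Fin 4)) = 1 → ∀ F : SchwartzMap (Fin n → EuclideanSpace ℝ (Fin 4)) ℂ, IsOffDiagonal F → S n σ (linActMulti Rot F) = S n σ F) → ∃ T : OSData (QCDField Nf) 4, T.schwinger = S ∧ T.IsNontrivial QCDField.glue ∧ T.IsNonGaussian QCDField.glue ∧ ∀ f g : Fin Nf, f ≠ g → T.IsNontrivial (QCDField.pseudoRe f g))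

/-! ## §2 The re-typed producer `LadderCauchyRate′` (route GapBuysCauchyRate, stmt-QuantumFields-17307) -/

/-- **`LadderCauchyRate′`**: the current `GapBuysCauchyRate.LadderCauchyRate` with, for every positive mass tuple `m`, the
three extra deliverables (T ∧ COMP), CL, CS of the calibrated scheme `𝒞.scheme m` inserted between the κ₃ clause and the
rate clause.  These are exactly what the constructive crux must prove about ITS OWN ladder (UV tightness of the calibrated
fields, the finite-size boundary-condition comparison, clustering uniform in the cutoff) — the honest placement of the
inputs, instead of asking `ConvergentOSClosure` to derive them from pointwise convergence and per-pair lattice-gap data. -/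
def LadderCauchyRateRetyped : Prop :=
  open Literature.MathematicalPhysics.QuantumFieldTheory Literature.MathematicalPhysics.QuantumLattice Literature.MathematicalPhysics.AQFT Summit.QuantumFields.QCD.Cruxes.StableActionBridge.Sketch in ∀ Nf : ℕ, Nf = 2 ∨ Nf = 3 → ∃ reg : QCDRegularisation Nf, reg.HasMassScaling ∧ (reg.scheme 0 0 0).HasAsymptoticScaling ∧ ∃ (𝒞 : CalibratedSpeciesFamily reg) (r : ℕ → ℝ), (Summable r ∧ reg.IsChiralAtZero) ∧ ∀ m : Fin Nf → ℝ, (∀ f, 0 < m f) → (∀ fl : Fin Nf, ∀ᶠ k in Filter.atTop, -1 < (𝒞.scheme m).mq fl k) ∧ (∃ Δ > 0, (𝒞.scheme m).HasLatticeMassGap Δ) ∧ (∀ᶠ k in Filter.atTop, (𝒞.scheme m).twoPoint k QCDField.glue QCDField.glue (thetaTest 4 𝒞.f₀) 𝒞.f₀ = 1) ∧ (∀ f g : Fin Nf, f ≠ g → ∀ᶠ k in Filter.atTop, (𝒞.scheme m).twoPoint k (QCDField.pseudoRe f g) (QCDField.pseudoRe f g) (thetaTest 4 𝒞.f₀) 𝒞.f₀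 = 1) ∧ (∃ f g h : SchwartzMap (EuclideanSpace ℝ (Fin 4)) ℝ, tsupport (f : EuclideanSpace ℝ (Fin 4) → ℝ) ⊆ {x | x 0 < 0} ∧ tsupport (g : EuclideanSpace ℝ (Fin 4) → ℝ) ⊆ {x | 0 < x 0 ∧ x 0 < 1} ∧ tsupport (h : EuclideanSpace ℝ (Fin 4) → ℝ) ⊆ {x | 1 < x 0} ∧ ∃ ε > (0 : ℝ), ∀ᶠ k in Filter.atTop, ε ≤ ‖qcdLatticeSchwinger (𝒞.scheme m) k 3 ![QCDField.glue, QCDField.glue, QCDField.glue] ![f, g, h] - qcdLatticeSchwinger (𝒞.scheme m) k 1 ![QCDField.glue] ![f] * qcdLatticeSchwinger (𝒞.scheme m) k 2 ![QCDField.glue, QCDField.glue] ![g, h] - qcdLatticeSchwinger (𝒞.scheme m) k 1 ![QCDField.glue] ![g] * qcdLatticeSchwinger (𝒞.scheme m) k 2 ![QCDField.glue, QCDField.glue] ![f, h] - qcdLatticeSchwinger (𝒞.scheme m) k 1 ![QCDField.glue] ![h] * qcdLatticeSchwinger (𝒞.scheme m) k 2 ![QCDField.glue, QCDField.glue] ![f,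 g] + 2 * (qcdLatticeSchwinger (𝒞.scheme m) k 1 ![QCDField.glue] ![f] * qcdLatticeSchwinger (𝒞.scheme m) k 1 ![QCDField.glue] ![g] * qcdLatticeSchwinger (𝒞.scheme m) k 1 ![QCDField.glue] ![h])‖) ∧ (∃ (s : ℕ) (α β : ℝ), 0 ≤ α ∧ (∀ (n : ℕ) (σ : Fin n → QCDField Nf), ∀ᶠ k in Filter.atTop, ∀ F : SchwartzMap (Fin n → EuclideanSpace ℝ (Fin 4)) ℂ, IsOffDiagonal F → ‖qcdLatticeDist (𝒞.scheme m) k n σ F‖ ≤ α * (n.factorial : ℝ) ^ β * schwartzNorm (n * s) F) ∧ (∀ ε : ℝ, 0 < ε → ∀ (n : ℕ) (σ : Fin n → QCDField Nf), ∀ᶠ k in Filter.atTop, ∀ F : SchwartzMap (Fin n → EuclideanSpace ℝ (Fin 4)) ℂ, IsOffDiagonal F → ‖qcdLatticeDistSymAP (𝒞.scheme m) k n σ F - qcdLatticeDist (𝒞.scheme m) k n σ F‖ ≤ ε * schwartzNorm (n * s) F)) ∧ (∀ (n n' : ℕ) (σ : Fin n → QCDField Nf) (σ' : Fin n' → QCDField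 Nf) (F : SchwartzMap (Fin n → EuclideanSpace ℝ (Fin 4)) ℂ) (G : SchwartzMap (Fin n' → EuclideanSpace ℝ (Fin 4)) ℂ), IsTimeOrdered F → IsTimeOrdered G → ∀ a : EuclideanSpace ℝ (Fin 4), a 0 = 0 → a ≠ 0 → ∀ ε : ℝ, 0 < ε → ∃ t₀ : ℝ, ∀ t : ℝ, t₀ ≤ t → ∀ H : SchwartzMap (Fin (n + n') → EuclideanSpace ℝ (Fin 4)) ℂ, IsAppendTensorOf H (osAdjoint F) (translateMulti (t • a) G) → ∀ᶠ k in Filter.atTop, ‖qcdLatticeDist (𝒞.scheme m) k (n + n') (Fin.append (σ ∘ Fin.rev) σ') H - qcdLatticeDist (𝒞.scheme m) k n (σ ∘ Fin.rev) (osAdjoint F) * qcdLatticeDist (𝒞.scheme m) k n' σ' G‖ ≤ ε) ∧ (∃ Δ' > 0, (𝒞.scheme m).HasSpeciesCSClustering Δ') ∧ ∀ n : ℕ, n ≠ 0 → ∀ (σ : Fin n → QCDField Nf) (f : Fin n → SchwartzMap (EuclideanSpace ℝ (Fin 4)) ℝ) (F : SchwartzMap (Fin n → EuclideanSpace ℝ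 (Fin 4)) ℂ), IsTensorOf F (fun i => ofRealTest (f i)) → IsOffDiagonal F → ∃ C : ℝ, ∀ k : ℕ, ‖qcdLatticeSchwinger (𝒞.scheme m) (k + 1) n σ f - qcdLatticeSchwinger (𝒞.scheme m) k n σ f‖ ≤ C * r k

/-! ## §4a The re-typed producer on route CounterexampleMustBeHot (stmt-QuantumFields-18044) -/

/-- **`ChiralCalibratedConvergence′`**: the current `CounterexampleMustBeHot.ChiralCalibratedConvergence` with the same three
clauses (T ∧ COMP), CL, CS appended, per positive mass tuple `m`, to the deliverables of the calibrated family `𝒞` over the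
re-indexed regularisation `reg₁`. -/
def ChiralCalibratedConvergenceRetyped : Prop :=
  open Literature.MathematicalPhysics.QuantumFieldTheory Literature.MathematicalPhysics.QuantumLattice Literature.MathematicalPhysics.AQFT Summit.QuantumFields.QCD.Cruxes.StableActionBridge.Sketch in ∀ Nf : ℕ, Nf = 2 ∨ Nf = 3 → ∀ reg : QCDRegularisation Nf, reg.HasMassScaling → reg.IsChiralAtZero → (reg.scheme 0 0 0).HasAsymptoticScaling → (∀ m : Fin Nf → ℝ, (∀ f, 0 < m f) → (∀ f, ∀ᶠ k in Filter.atTop, -1 < (reg.scheme m 0 0).mq f k) ∧ ∃ Δ > 0, (reg.scheme m 0 0).HasLatticeMassGap Δ) → ∃ (φ : ℕ → ℕ) (reg₁ : QCDRegularisation Nf), StrictMono φ ∧ reg₁.a = reg.a ∘ φ ∧ reg₁.β = reg.β ∘ φ ∧ reg₁.mcrit = reg.mcrit ∘ φ ∧ reg₁.Zm = reg.Zm ∘ φ ∧ (∀ k, reg.L (φ k) ≤ reg₁.L k) ∧ reg₁.IsChiralAtZero ∧ ∃ 𝒞 : CalibratedSpeciesFamily reg₁, ∀ m : Fin Nf →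 ℝ, (∀ f, 0 < m f) → (∀ᶠ k in Filter.atTop, (𝒞.scheme m).twoPoint k QCDField.glue QCDField.glue (thetaTest 4 𝒞.f₀) 𝒞.f₀ = 1) ∧ (∀ f g : Fin Nf, f ≠ g → ∀ᶠ k in Filter.atTop, (𝒞.scheme m).twoPoint k (QCDField.pseudoRe f g) (QCDField.pseudoRe f g) (thetaTest 4 𝒞.f₀) 𝒞.f₀ = 1) ∧ (∃ f g h : SchwartzMap (EuclideanSpace ℝ (Fin 4)) ℝ, tsupport (f : EuclideanSpace ℝ (Fin 4) → ℝ) ⊆ {x | x 0 < 0} ∧ tsupport (g : EuclideanSpace ℝ (Fin 4) → ℝ) ⊆ {x | 0 < x 0 ∧ x 0 < 1} ∧ tsupport (h : EuclideanSpace ℝ (Fin 4) → ℝ) ⊆ {x | 1 < x 0} ∧ ∃ ε > (0 : ℝ), ∀ᶠ k in Filter.atTop, ε ≤ ‖qcdLatticeSchwinger (𝒞.scheme m) k 3 ![QCDField.glue, QCDField.glue, QCDField.glue] ![f, g, h] - qcdLatticeSchwinger (𝒞.scheme m) k 1 ![QCDField.glue] ![f] * qcdLatticeSchwinger (𝒞.scheme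 m) k 2 ![QCDField.glue, QCDField.glue] ![g, h] - qcdLatticeSchwinger (𝒞.scheme m) k 1 ![QCDField.glue] ![g] * qcdLatticeSchwinger (𝒞.scheme m) k 2 ![QCDField.glue, QCDField.glue] ![f, h] - qcdLatticeSchwinger (𝒞.scheme m) k 1 ![QCDField.glue] ![h] * qcdLatticeSchwinger (𝒞.scheme m) k 2 ![QCDField.glue, QCDField.glue] ![f, g] + 2 * (qcdLatticeSchwinger (𝒞.scheme m) k 1 ![QCDField.glue] ![f] * qcdLatticeSchwinger (𝒞.scheme m) k 1 ![QCDField.glue] ![g] * qcdLatticeSchwinger (𝒞.scheme m) k 1 ![QCDField.glue] ![h])‖) ∧ (∀ n : ℕ, n ≠ 0 → ∀ (σ : Fin n → QCDField Nf) (f : Fin n → SchwartzMap (EuclideanSpace ℝ (Fin 4)) ℝ) (F : SchwartzMap (Fin n → EuclideanSpace ℝ (Fin 4)) ℂ), IsTensorOf F (fun i => ofRealTest (f i)) → IsOffDiagonal F → ∃ c : ℂ, Filter.Tendsto (fun k : ℕ => qcdLatticeSchwinger (𝒞.scheme m) k n σ f) Filter.atTop (nhds c)) ∧ (∃ (s :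 ℕ) (α β : ℝ), 0 ≤ α ∧ (∀ (n : ℕ) (σ : Fin n → QCDField Nf), ∀ᶠ k in Filter.atTop, ∀ F : SchwartzMap (Fin n → EuclideanSpace ℝ (Fin 4)) ℂ, IsOffDiagonal F → ‖qcdLatticeDist (𝒞.scheme m) k n σ F‖ ≤ α * (n.factorial : ℝ) ^ β * schwartzNorm (n * s) F) ∧ (∀ ε : ℝ, 0 < ε → ∀ (n : ℕ) (σ : Fin n → QCDField Nf), ∀ᶠ k in Filter.atTop, ∀ F : SchwartzMap (Fin n → EuclideanSpace ℝ (Fin 4)) ℂ, IsOffDiagonal F → ‖qcdLatticeDistSymAP (𝒞.scheme m) k n σ F - qcdLatticeDist (𝒞.scheme m) k n σ F‖ ≤ ε * schwartzNorm (n * s) F)) ∧ (∀ (n n' : ℕ) (σ : Fin n → QCDField Nf) (σ' : Fin n' → QCDField Nf) (F : SchwartzMap (Fin n → EuclideanSpace ℝ (Fin 4)) ℂ) (G : SchwartzMap (Fin n' → EuclideanSpace ℝ (Fin 4)) ℂ), IsTimeOrdered F → IsTimeOrdered G → ∀ a : EuclideanSpace ℝ (Fin 4), a 0 = 0 → a ≠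 0 → ∀ ε : ℝ, 0 < ε → ∃ t₀ : ℝ, ∀ t : ℝ, t₀ ≤ t → ∀ H : SchwartzMap (Fin (n + n') → EuclideanSpace ℝ (Fin 4)) ℂ, IsAppendTensorOf H (osAdjoint F) (translateMulti (t • a) G) → ∀ᶠ k in Filter.atTop, ‖qcdLatticeDist (𝒞.scheme m) k (n + n') (Fin.append (σ ∘ Fin.rev) σ') H - qcdLatticeDist (𝒞.scheme m) k n (σ ∘ Fin.rev) (osAdjoint F) * qcdLatticeDist (𝒞.scheme m) k n' σ' G‖ ≤ ε) ∧ (∃ Δ' > 0, (𝒞.scheme m).HasSpeciesCSClustering Δ')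

open Literature.MathematicalPhysics.AQFT Literature.MathematicalPhysics.QuantumLattice
  Literature.MathematicalPhysics.QuantumFieldTheory
open Summit.QuantumFields.QCD.Theorems.ConvergentOSClosure (stub_softClosure stub_asymptoticTranslation
  stub_speciesPackaging stub_rpOfComparison)

/-- **R′ is a theorem over the landed files** (lead c2's 12-line proof; after the re-type this is the closing proof of
stmt-QuantumFields-11525, to be landed as `Theorems/GapBuysCauchyRateConvergentOSClosure.lean`). -/
theorem convergentOSClosureRetyped_holds : ConvergentOSClosureRetyped := by
  intro Nf reg 𝒞 m hNf hm hAS hbr hgap h2g h2q h3g hconv hTC hcl hCS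
  obtain ⟨s, α, β, hα, hb, hcomp⟩ := hTC
  have htr := stub_asymptoticTranslation Nf reg 𝒞 m hm hAS hbr hgap h2g h2q hconv s α β hα hb
  have hrp := stub_rpOfComparison Nf (𝒞.scheme m)
    (QCDScheme.eventually_le_beta_of_hasAsymptoticScaling hNf (𝒞.scheme m) hAS 0) hbr s α β hα hb hcomp
  obtain ⟨Δ, hΔ, hgapΔ⟩ := hgap
  obtain ⟨Δ', hΔ', hCS'⟩ := hCS
  obtain ⟨S, h0, h0', hE0', hE1t, hE2, hE3, hE4, htensor, hgap₀⟩ :=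
    stub_softClosure Nf (𝒞.scheme m) hconv s α β hα hb htr hrp hcl Δ Δ' hΔ hΔ' hgapΔ hCS'
  exact ⟨S, h0, h0', hE0', hE1t, hE2, hE3, hE4, htensor, hgap₀, fun hRot =>
    stub_speciesPackaging Nf reg 𝒞 m h2g h2q h3g S ⟨⟨h0, h0', ⟨hE1t, hRot⟩, hE2, hE3, hE4⟩, hE0'⟩ htensor⟩

/-- The crux as typed implies R′ (re-typing the consumer loses nothing). -/
theorem convergentOSClosureRetyped_of_original
    (h : Summit.QuantumFields.QCD.Theses.GapBuysCauchyRate.ConvergentOSClosure) : ConvergentOSClosureRetyped :=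
  fun Nf reg 𝒞 m _ hm hAS hbr hgap h2g h2q h3g hconv _ _ _ =>
    h Nf reg 𝒞 m hm hAS hbr hgap h2g h2q h3g hconv

/-- `LadderCauchyRate′` implies the current `LadderCauchyRate` (re-typing the producer only ADDS deliverables). -/
theorem ladderCauchyRateRetyped_imp (h : LadderCauchyRateRetyped) :
    Summit.QuantumFields.QCD.Theses.GapBuysCauchyRate.LadderCauchyRate := by
  intro Nf hNf
  obtain ⟨reg, hms, hAS, 𝒞, r, hr, H⟩ := h Nf hNf
  refine ⟨reg, hms, hAS, 𝒞, r, hr, fun m hm => ?_⟩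
  obtain ⟨hbr, hgap, h2g, h2q, h3g, -, -, -, hrate⟩ := H m hm
  exact ⟨hbr, hgap, h2g, h2q, h3g, hrate⟩

/-! ## §3 The deciding theorem of route GapBuysCauchyRate, re-certified on the re-typed items -/

/-- **`closes′`** — `LadderCauchyRate′ → CauchySummation → ConvergentOSClosure′ → RotationRestoration → QCD`: the route's
deciding theorem after the re-type (same 25 lines of pure logic as the current `closes`, plus `N_f ≤ 16` from
`N_f = 2 ∨ N_f = 3` and the three new clauses passed from producer to consumer). -/
theorem closesRetyped (h₁ : LadderCauchyRateRetyped)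
    (h₂ : Summit.QuantumFields.QCD.Theses.GapBuysCauchyRate.CauchySummation) (h₃ : ConvergentOSClosureRetyped)
    (h₄ : Summit.QuantumFields.QCD.Theses.GapBuysCauchyRate.RotationRestoration) : _root_.QCD := by
  have key : ∀ Nf : ℕ, Nf = 2 ∨ Nf = 3 → QCDOf Nf := by
    intro Nf hNf
    have hNf16 : Nf ≤ 16 := by rcases hNf with rfl | rfl <;> norm_num
    obtain ⟨reg, hms, hAS, 𝒞, r, ⟨hr, hχ⟩, H⟩ := h₁ Nf hNf
    refine ⟨reg, hms, hχ, fun m hm => ?_⟩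
    obtain ⟨hbr, hgap, h2g, h2q, h3g, hTC, hcl, hCS, hrate⟩ := H m hm
    have hAS' : (𝒞.scheme m).HasAsymptoticScaling := hAS
    have hconv : ∀ n : ℕ, n ≠ 0 → ∀ (σ : Fin n → QCDField Nf) (f : Fin n → SchwartzMap (EuclideanSpace ℝ (Fin 4)) ℝ)
        (F : SchwartzMap (Fin n → EuclideanSpace ℝ (Fin 4)) ℂ), IsTensorOf F (fun i => ofRealTest (f i)) →
          IsOffDiagonal F → ∃ c : ℂ, Tendsto (fun k : ℕ => qcdLatticeSchwinger (𝒞.scheme m) k n σ f) atTop (nhds c) := by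
      intro n hn σ f F hF hoff
      obtain ⟨C, hC⟩ := hrate n hn σ f F hF hoff
      exact h₂ _ r C hr hC
    obtain ⟨S, -, -, -, -, -, -, -, hConvS, ⟨Δ, hΔ, hGapS, hGapL⟩, hPack⟩ :=
      h₃ Nf reg 𝒞 m hNf16 hm hAS' hbr hgap h2g h2q h3g hconv hTC hcl hCS
    have hE1 := h₄ Nf (𝒞.scheme m) hAS' hbr ⟨Δ, hΔ, hGapL⟩ S hConvS
    obtain ⟨T, hTS, hNT, hNG, hND⟩ := hPack hE1
    subst hTS
    exact ⟨𝒞.z m, 𝒞.shift m, T, ⟨hAS', hbr, hConvS⟩, hNT, hNG, hND, Δ, hΔ, hGapS, hGapL⟩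
  exact ⟨key 2 (Or.inl rfl), key 3 (Or.inr rfl)⟩

/-- **After the re-type the route is down to two open cruxes**: `LadderCauchyRate′` and `RotationRestoration` give `QCD`
(`CauchySummation` is the landed `cauchySummation_proof`, R′ is `convergentOSClosureRetyped_holds`). -/
theorem qcd_of_ladderRetyped (h₁ : LadderCauchyRateRetyped)
    (h₄ : Summit.QuantumFields.QCD.Theses.GapBuysCauchyRate.RotationRestoration) : _root_.QCD :=
  closesRetyped h₁ Summit.QuantumFields.QCD.Theorems.cauchySummation_proof convergentOSClosureRetyped_holds h₄

/-! ## §4b The CounterexampleMustBeHot copy: the split of `ChiralContinuumComplement` re-certified -/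

/-- The two route copies of `RotationRestoration` are the same proposition (shared item stmt-QuantumFields-8840). -/
theorem rotationRestoration_copies_agree :
    Summit.QuantumFields.QCD.Theses.GapBuysCauchyRate.RotationRestoration ↔
      Summit.QuantumFields.QCD.Theses.CounterexampleMustBeHot.RotationRestoration :=
  Iff.rfl

/-- The two route copies of `ConvergentOSClosure` are the same proposition (so ONE re-typed text serves both). -/
theorem convergentOSClosure_copies_agree :
    Summit.QuantumFields.QCD.Theses.GapBuysCauchyRate.ConvergentOSClosure ↔
      Summit.QuantumFields.QCD.Theses.CounterexampleMustBeHot.ConvergentOSClosure :=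
  Iff.rfl

/-- `ChiralCalibratedConvergence′` implies the current `ChiralCalibratedConvergence` (only deliverables were added). -/
theorem chiralCalibratedConvergenceRetyped_imp (h : ChiralCalibratedConvergenceRetyped) :
    Summit.QuantumFields.QCD.Theses.CounterexampleMustBeHot.ChiralCalibratedConvergence := by
  intro Nf hNf reg hms hchi has H
  obtain ⟨φ, reg₁, hφ, ha, hβ, hmc, hZm, hL, hchi₁, 𝒞, H₁⟩ := h Nf hNf reg hms hchi has H
  refine ⟨φ, reg₁, hφ, ha, hβ, hmc, hZm, hL, hchi₁, 𝒞, fun m hm => ?_⟩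
  obtain ⟨h2g, h2q, h3g, hconv, -, -, -⟩ := H₁ m hm
  exact ⟨h2g, h2q, h3g, hconv⟩

/-- **The split of `ChiralContinuumComplement` (stmt-QuantumFields-17304) re-certified on the re-typed pieces**:
`ChiralCalibratedConvergence′ → ConvergentOSClosure′ → RotationRestoration → ChiralContinuumComplement` (the glue of
`Cruxes/ChiralContinuumComplement/Lines/pieces.lean`, with `N_f ≤ 16` and the three clauses threaded through). -/
theorem chiralContinuumComplement_of_retyped (h₁ : ChiralCalibratedConvergenceRetyped) (h₂ : ConvergentOSClosureRetyped)
    (h₃ : Summit.QuantumFields.QCD.Theses.CounterexampleMustBeHot.RotationRestoration) :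
    Summit.QuantumFields.QCD.Theses.CounterexampleMustBeHot.ChiralContinuumComplement := by
  intro hCLH
  have key : ∀ Nf : ℕ, Nf = 2 ∨ Nf = 3 → QCDOf Nf := by
    intro Nf hNf
    have hNf16 : Nf ≤ 16 := by rcases hNf with rfl | rfl <;> norm_num
    obtain ⟨reg, hms, hchi, has, H⟩ := hCLH Nf hNf
    obtain ⟨φ, reg₁, hφ, ha, hβ, hmc, hZm, hL, hchi₁, 𝒞, H₁⟩ := h₁ Nf hNf reg hms hchi has H
    -- (i) leading-log mass scaling rides along the subsequence (reads `a`, `Z_m` only)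
    have hms₁ : reg₁.HasMassScaling := by
      obtain ⟨c, hc, ht⟩ := hms
      refine ⟨c, hc, ?_⟩
      have hfun : (fun k => reg₁.Zm k / Real.log (1 / reg₁.a k ^ 2) ^ massExponent Nf) =
          (fun k => reg.Zm k / Real.log (1 / reg.a k ^ 2) ^ massExponent Nf) ∘ φ := by
        funext k; simp [ha, hZm]
      rw [hfun]
      exact ht.comp hφ.tendsto_atTop
    refine ⟨reg₁, hms₁, hchi₁, fun m hm => ?_⟩
    obtain ⟨hbr, Δ, hΔ, hgap⟩ := H m hm
    obtain ⟨h2g, h2q, h3g, hconv, hTC, hcl, hCS⟩ := H₁ m hm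
    -- (ii) two-loop asymptotic scaling rides along (reads `β`, `a` only)
    have has₁ : (𝒞.scheme m).HasAsymptoticScaling := by
      obtain ⟨Λ, hΛ, ht⟩ := has
      refine ⟨Λ, hΛ, ?_⟩
      have hfun : (fun k => (𝒞.scheme m).β k - afBeta Nf Λ ((𝒞.scheme m).a k)) =
          (fun k => (reg.scheme 0 0 0).β k - afBeta Nf Λ ((reg.scheme 0 0 0).a k)) ∘ φ := by
        funext k
        simp [QCDRegularisation.scheme, CalibratedSpeciesFamily.scheme, ha, hβ]
      rw [hfun]
      exact ht.comp hφ.tendsto_atTop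
    -- (iii) the physical branch rides along (reads `m_crit`, `a`, `Z_m`)
    have hbr₁ : ∀ fl : Fin Nf, ∀ᶠ k in Filter.atTop, -1 < (𝒞.scheme m).mq fl k := by
      intro fl
      refine (hφ.tendsto_atTop.eventually (hbr fl)).mono fun k hk => ?_
      simpa [ha, hmc, hZm] using hk
    -- (iv) the uniform lattice gap rides along and survives the volume ENLARGEMENT
    have hgap₁ : (𝒞.scheme m).HasLatticeMassGap Δ := by
      intro R R' A B
      obtain ⟨C, hC⟩ := hgap R R' A B
      refine ⟨C, (hφ.tendsto_atTop.eventually hC).mono fun k hk S hS n hn => ?_⟩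
      have hS' : (reg.scheme m 0 0).L (φ k) ≤ S :=
        (hL k).trans (by simpa [CalibratedSpeciesFamily.scheme, QCDRegularisation.scheme] using hS)
      simpa [QCDRegularisation.scheme, CalibratedSpeciesFamily.scheme, ha, hβ, hmc, hZm] using hk S hS' n hn
    -- OS closure of the convergent calibrated family (re-typed piece 2), rotations (piece 3), packaging
    obtain ⟨S, -, -, -, -, -, -, -, hConvS, ⟨Δ', hΔ', hGapS, hGapL⟩, hPack⟩ :=
      h₂ Nf reg₁ 𝒞 m hNf16 hm has₁ hbr₁ ⟨Δ, hΔ, hgap₁⟩ h2g h2q h3g hconv hTC hcl hCS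
    have hE1 := h₃ Nf (𝒞.scheme m) has₁ hbr₁ ⟨Δ', hΔ', hGapL⟩ S hConvS
    obtain ⟨T, hTS, hNT, hNG, hND⟩ := hPack hE1
    subst hTS
    exact ⟨𝒞.z m, 𝒞.shift m, T, ⟨has₁, hbr₁, hConvS⟩, hNT, hNG, hND, Δ', hΔ', hGapS, hGapL⟩
  exact ⟨key 2 (Or.inl rfl), key 3 (Or.inr rfl)⟩

/-- After the re-type the split of `ChiralContinuumComplement` is down to two open pieces as well:
`ChiralCalibratedConvergence′` and `RotationRestoration`. -/
theorem chiralContinuumComplement_of_ladder' (h₁ : ChiralCalibratedConvergenceRetyped)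
    (h₃ : Summit.QuantumFields.QCD.Theses.CounterexampleMustBeHot.RotationRestoration) :
    Summit.QuantumFields.QCD.Theses.CounterexampleMustBeHot.ChiralContinuumComplement :=
  chiralContinuumComplement_of_retyped h₁ convergentOSClosureRetyped_holds h₃

end Summit.QuantumFields.QCD.Cruxes.ConvergentOSClosure.RetypeRoute
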